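import Summits.QuantumFields.YangMills.Theorems.PoincareLipschitzMonotonicityOfRadialInequality
import Mathlib.MeasureTheory.Integral.Bochner.ContinuousLinearMap
import Mathlib.MeasureTheory.Integral.IntervalIntegral.FundThmCalculus
import Mathlib.Analysis.InnerProductSpace.PiL2
import HarnessLib

/-!
# Crux `BlockLipschitzL` (stmt-QuantumFields-23533) ∕ `HistoryTailL` (stmt-QuantumFields-19936), LINE 25 «CompactnessTransfer»,
# stub S1″ — the (TM) re-cut, file TM-C1 «RADIAL PUSH-FORWARD LETTERS»

Cell `ym3-torus` (YM ladder rung R3 = continuum SU(2) Yang–Mills on T³ — a RUNG, NOT Clay: not d = 4, not infinite volume,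
not a mass gap); WIDTH helper seat `ym3-torus-px3` g9 (LEAD ★w1-19936 g10 «GO (TM)» 14:49:45Z); `--supports
stmt-QuantumFields-23533`; THEOREMS ONLY (0 `def`, 0 `sorry`, default heartbeats); imports ✓`PoincareLipschitzMonotonicityOfRadialInequality`
(★w3 g15 (δ2); through it ✓`PoincareLipschitzRadialCutoffLetters`: the cutoff `g_κ(s) = smoothTransition((1−s)∕κ)`) + Mathlib.

WHAT THIS FILE DOES (letters for TM-C2 «monotonicity equality ⇒ radial derivative zero»):
* §1 ★★ `setIntegral_radial_mul_eq_of_ball_linear` — **THE RADIAL PUSH-FORWARD**: if `f ≥ 0` is integrable on `B_R(y) ⊂ ℝ³`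
  and its ball integrals are LINEAR, `∫_{B_r(y)} f = Θ·r` for `0 < r ≤ R`, then for every continuous `k : ℝ → ℝ`,
  `∫_{B_R(y)} k(dist(x,y))·f(x) dx = Θ·∫₀^R k` (the push-forward of `f·dx` under `dist(·,y)` is `Θ·dr` on `(0,R]`:
  π-system uniqueness on the rays `Iio a`, ✓`ext_of_generate_finite`; then `integral_map` + `integral_withDensity_eq_integral_smul₀`).
* §2 ★ `intervalIntegral_profile_eq_zero` — `∫₀^R (g(r²∕τ²) + 2(r²∕τ²)g′(r²∕τ²)) dr = R·g(R²∕τ²)` (`= 0` when `g` vanishes on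
  `[1,∞)` and `τ < R`): the integrand is `d∕dr [r·g(r²∕τ²)]`.
* §3 ★ `exists_window_cutoff_deriv_neg` — for the cutoff `g₁(s) = smoothTransition(1 − s)` there are `0 < j₁ < j₂ < 3∕4` with
  `g₁′(s) < 0` whenever `1 − s ∈ (j₁, j₂)` (mean value theorem on `[0, 3∕4]` + continuity of `smoothTransition′`), and
  `g₁′ ≤ 0`, `|g₁′| ≤ M` everywhere.
HONEST SCOPE.  Letters only; nothing of (TM), (ZD), (C), S1″, K1, `MeanDeviationL`, `BlockLipschitzL`, `HistoryTailL` is proved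
here.  YM₃ on T³ is rung R3, not Clay; YM gap NOT proved; no summit statement is proved here.

References: L. Simon, Theorems on Regularity and Singularity of Energy Minimizing Maps (1996) [Simon1996] (§2.4: the
monotonicity identity and its equality case, §3.1: densities); L. C. Evans, R. F. Gariepy, Measure Theory and Fine Properties of
Functions (1992) [EvansGariepy1992] (§1.1: push-forward ∕ layer-cake bookkeeping).
-/

set_option autoImplicit false

noncomputable section

open scoped BigOperators Topology ENNReal NNReal
open MeasureTheory Set Filter Metric Function TopologicalSpace

namespace Summit.QuantumFields.YangMills.Theorems.PoincareLipschitzMonotonicityEqualityLetters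

open Summit.QuantumFields.YangMills.Theorems.PoincareLipschitzRadialCutoffLetters (cutoff_contDiff cutoff_eq_zero
  cutoff_deriv_nonpos cutoff_deriv_continuous)
open Summit.QuantumFields.YangMills.Theorems.PoincareLipschitzMonotonicityOfRadialInequality (exists_bound_cutoff_deriv)

/-! ## §1 The radial push-forward of a density with linear ball integrals -/

/-- Intersections of concentric balls. [folklore] -/
theorem ball_inter_ball_eq_min (y : EuclideanSpace ℝ (Fin 3)) (a R : ℝ) :
    ball y a ∩ ball y R = ball y (min a R) := by
  ext x; simp [mem_ball]

/-- The preimage of a ray under `dist(·, y)` is a ball. [folklore] -/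
theorem preimage_dist_Iio (y : EuclideanSpace ℝ (Fin 3)) (a : ℝ) :
    (fun x : EuclideanSpace ℝ (Fin 3) => dist x y) ⁻¹' Iio a = ball y a := by
  ext x; simp [mem_ball]

/-- ★★ **THE RADIAL PUSH-FORWARD.**  Let `f ≥ 0` be integrable on the ball `B_R(y) ⊂ ℝ³` (`R > 0`) with LINEAR ball integrals
`∫_{B_r(y)} f = Θ·r` for all `0 < r ≤ R`.  Then for every continuous `k : ℝ → ℝ`,
`∫_{B_R(y)} k(dist(x, y))·f(x) dx = Θ · ∫₀^R k(r) dr`.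
Proof: the finite measure `μ := f·dx⌊B_R(y)` pushed forward by `dist(·,y)` agrees with `Θ·dr⌊(0,R]` on every ray `Iio a`
(both give `Θ·min(a,R)⁺`), hence everywhere (π-system uniqueness); integrate `k`. [cite: Simon1996, §2.4 and §3.1; EvansGariepy1992, §1.1] -/
theorem setIntegral_radial_mul_eq_of_ball_linear {y : EuclideanSpace ℝ (Fin 3)} {R Θ : ℝ} (hR : 0 < R)
    {f : EuclideanSpace ℝ (Fin 3) → ℝ} (hf0 : ∀ x, 0 ≤ f x) (hfi : IntegrableOn f (ball y R) volume)
    (hE : ∀ r : ℝ, 0 < r → r ≤ R → ∫ x in ball y r, f x = Θ * r) {k : ℝ → ℝ} (hk : Continuous k) :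
    ∫ x in ball y R, k (dist x y) * f x = Θ * ∫ r in (0:ℝ)..R, k r := by
  -- `Θ ≥ 0`
  have hΘ : 0 ≤ Θ := by
    have h := hE R hR le_rfl
    have h0 : 0 ≤ ∫ x in ball y R, f x := setIntegral_nonneg measurableSet_ball fun x _ => hf0 x
    nlinarith
  -- the finite measure `μ = f · dx ⌊ B_R(y)` and its radial push-forward `ν`
  set μ : Measure (EuclideanSpace ℝ (Fin 3)) :=
    (volume.restrict (ball y R)).withDensity (fun x => ((f x).toNNReal : ℝ≥0∞)) with hμ_def
  have hfm : AEMeasurable (fun x => (f x).toNNReal) (volume.restrict (ball y R)) :=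
    hfi.aestronglyMeasurable.aemeasurable.real_toNNReal
  have hμball : ∀ a : ℝ, μ (ball y a) = ENNReal.ofReal (∫ x in ball y (min a R), f x) := by
    intro a
    rw [hμ_def, withDensity_apply _ measurableSet_ball, Measure.restrict_restrict measurableSet_ball,
      ball_inter_ball_eq_min]
    have hfi' : IntegrableOn f (ball y (min a R)) volume := hfi.mono_set (ball_subset_ball (min_le_right _ _))
    rw [ofReal_integral_eq_lintegral_ofReal hfi' (ae_of_all _ fun x => hf0 x)]
    rfl
  have hμuniv : μ univ = ENNReal.ofReal (Θ * R) := by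
    rw [hμ_def, withDensity_apply _ MeasurableSet.univ, Measure.restrict_univ, ← hE R hR le_rfl,
      ofReal_integral_eq_lintegral_ofReal hfi (ae_of_all _ fun x => hf0 x)]
    rfl
  haveI hμfin : IsFiniteMeasure μ := ⟨by rw [hμuniv]; exact ENNReal.ofReal_lt_top⟩
  have hdm : Measurable (fun x : EuclideanSpace ℝ (Fin 3) => dist x y) := (continuous_id.dist continuous_const).measurable
  set ν : Measure ℝ := μ.map (fun x => dist x y) with hν_def
  haveI hνfin : IsFiniteMeasure ν := Measure.isFiniteMeasure_map _ _
  set ν' : Measure ℝ := ENNReal.ofReal Θ • volume.restrict (Ioc (0:ℝ) R) with hν'_def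
  -- the two measures agree on rays
  have hray : ∀ a : ℝ, ν (Iio a) = ν' (Iio a) := by
    intro a
    rw [hν_def, Measure.map_apply hdm measurableSet_Iio, preimage_dist_Iio, hμball, hν'_def, Measure.smul_apply,
      Measure.restrict_apply measurableSet_Iio, smul_eq_mul]
    by_cases ha : a ≤ 0
    · have h1 : ball y (min a R) = ∅ := ball_eq_empty.2 ((min_le_left _ _).trans ha)
      have h2 : Iio a ∩ Ioc (0:ℝ) R = ∅ := by
        ext r; simp only [mem_inter_iff, mem_Iio, mem_Ioc, mem_empty_iff_false, iff_false]; intro h; linarith [h.1, h.2.1]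
      rw [h1, h2, Measure.restrict_empty, integral_zero_measure, measure_empty, ENNReal.ofReal_zero, mul_zero]
    · push Not at ha
      have hm : 0 < min a R := lt_min ha hR
      rw [hE (min a R) hm (min_le_right _ _), ENNReal.ofReal_mul hΘ]
      congr 1
      by_cases haR : a ≤ R
      · have h2 : Iio a ∩ Ioc (0:ℝ) R = Ioo 0 a := by
          ext r; simp only [mem_inter_iff, mem_Iio, mem_Ioc, mem_Ioo]
          constructor
          · rintro ⟨h1, h2, _⟩; exact ⟨h2, h1⟩
          · rintro ⟨h1, h2⟩; exact ⟨h2, h1, h2.le.trans haR⟩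
        rw [h2, Real.volume_Ioo, min_eq_left haR, sub_zero]
      · push Not at haR
        have h2 : Iio a ∩ Ioc (0:ℝ) R = Ioc 0 R := by
          ext r; simp only [mem_inter_iff, mem_Iio, mem_Ioc]
          constructor
          · rintro ⟨_, h2, h3⟩; exact ⟨h2, h3⟩
          · rintro ⟨h2, h3⟩; exact ⟨lt_of_le_of_lt h3 haR, h2, h3⟩
        rw [h2, Real.volume_Ioc, min_eq_right haR.le, sub_zero]
  have hνeq : ν = ν' := by
    refine ext_of_generate_finite (range (Iio : ℝ → Set ℝ)) ?_ isPiSystem_Iio ?_ ?_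
    · rw [← borel_eq_generateFrom_Iio]; exact BorelSpace.measurable_eq
    · rintro s ⟨a, rfl⟩; exact hray a
    · rw [hν_def, Measure.map_apply hdm MeasurableSet.univ, preimage_univ, hμuniv, hν'_def, Measure.smul_apply,
        Measure.restrict_apply MeasurableSet.univ, univ_inter, Real.volume_Ioc, smul_eq_mul, ← ENNReal.ofReal_mul hΘ, sub_zero]
  -- integrate `k`
  have hkm : AEStronglyMeasurable k ν := hk.aestronglyMeasurable
  have h1 : ∫ r, k r ∂ν = ∫ x, k (dist x y) ∂μ := integral_map hdm.aemeasurable hkm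
  have h2 : ∫ x, k (dist x y) ∂μ = ∫ x in ball y R, k (dist x y) * f x := by
    rw [hμ_def, integral_withDensity_eq_integral_smul₀ hfm]
    refine integral_congr_ae (ae_of_all _ fun x => ?_)
    show (f x).toNNReal • k (dist x y) = k (dist x y) * f x
    rw [NNReal.smul_def, Real.coe_toNNReal _ (hf0 x), smul_eq_mul, mul_comm]
  have h3 : ∫ r, k r ∂ν' = Θ * ∫ r in (0:ℝ)..R, k r := by
    rw [hν'_def, integral_smul_measure, ENNReal.toReal_ofReal hΘ, intervalIntegral.integral_of_le hR.le, smul_eq_mul]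
  rw [← h2, ← h1, hνeq, h3]

/-! ## §2 The radial profile integrates to zero -/

/-- ★ **THE PROFILE IS AN EXACT DERIVATIVE**: `∫₀^R (g(r²∕τ²) + 2(r²∕τ²)·g′(r²∕τ²)) dr = R·g(R²∕τ²)` for `C¹` `g`
(the integrand is `(r·g(r²∕τ²))′`). [folklore] -/
theorem intervalIntegral_profile_eq {g : ℝ → ℝ} (hg : ContDiff ℝ 1 g) (τ R : ℝ) :
    ∫ r in (0:ℝ)..R, (g (r ^ 2 / τ ^ 2) + 2 * (r ^ 2 / τ ^ 2) * deriv g (r ^ 2 / τ ^ 2)) = R * g (R ^ 2 / τ ^ 2) := by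
  have hgd : Differentiable ℝ g := hg.differentiable one_ne_zero
  have hg'c : Continuous (deriv g) := hg.continuous_deriv le_rfl
  have hderiv : ∀ r : ℝ, HasDerivAt (fun r : ℝ => r * g (r ^ 2 / τ ^ 2))
      (g (r ^ 2 / τ ^ 2) + 2 * (r ^ 2 / τ ^ 2) * deriv g (r ^ 2 / τ ^ 2)) r := by
    intro r
    have h1 : HasDerivAt (fun r : ℝ => r ^ 2 / τ ^ 2) (2 * r / τ ^ 2) r := by
      have := (hasDerivAt_pow 2 r).div_const (τ ^ 2)
      simpa [pow_one] using this
    have h2 : HasDerivAt (fun r : ℝ => g (r ^ 2 / τ ^ 2)) (deriv g (r ^ 2 / τ ^ 2) * (2 * r / τ ^ 2)) r :=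
      (hgd _).hasDerivAt.comp r h1
    have h3 : HasDerivAt (fun r : ℝ => r * g (r ^ 2 / τ ^ 2))
        (1 * g (r ^ 2 / τ ^ 2) + r * (deriv g (r ^ 2 / τ ^ 2) * (2 * r / τ ^ 2))) r := (hasDerivAt_id' r).mul h2
    refine h3.congr_deriv ?_
    field_simp
  have hcont : Continuous (fun r : ℝ => g (r ^ 2 / τ ^ 2) + 2 * (r ^ 2 / τ ^ 2) * deriv g (r ^ 2 / τ ^ 2)) := by
    have hc1 : Continuous (fun r : ℝ => r ^ 2 / τ ^ 2) := (continuous_pow 2).div_const _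
    exact (hgd.continuous.comp hc1).add ((continuous_const.mul hc1).mul (hg'c.comp hc1))
  rw [intervalIntegral.integral_eq_sub_of_hasDerivAt (fun r _ => hderiv r) (hcont.intervalIntegrable _ _)]
  simp

/-- ★ For a profile vanishing on `[1, ∞)` and `0 < τ < R`: `∫₀^R (g(r²∕τ²) + 2(r²∕τ²)·g′(r²∕τ²)) dr = 0`. [folklore] -/
theorem intervalIntegral_profile_eq_zero {g : ℝ → ℝ} (hg : ContDiff ℝ 1 g) (hg0 : ∀ s : ℝ, 1 ≤ s → g s = 0)
    {τ R : ℝ} (hτ : 0 < τ) (hτR : τ < R) :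
    ∫ r in (0:ℝ)..R, (g (r ^ 2 / τ ^ 2) + 2 * (r ^ 2 / τ ^ 2) * deriv g (r ^ 2 / τ ^ 2)) = 0 := by
  rw [intervalIntegral_profile_eq hg τ R, hg0 _ ?_, mul_zero]
  rw [le_div_iff₀ (by positivity), one_mul]
  exact pow_le_pow_left₀ hτ.le hτR.le 2

/-! ## §3 A window where the cutoff's derivative is strictly negative -/

/-- ★ **A NEGATIVITY WINDOW FOR THE CUTOFF DERIVATIVE.**  For `g₁(s) := smoothTransition((1 − s)∕1)` there are
`0 < j₁ < j₂ < 3∕4` with `deriv g₁ s < 0` whenever `j₁ < 1 − s < j₂` (mean value theorem for `smoothTransition` on `[0, 3∕4]`,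
where it climbs from `0` to a positive value, and continuity of its derivative). [folklore] -/
theorem exists_window_cutoff_deriv_neg :
    ∃ j₁ j₂ : ℝ, 0 < j₁ ∧ j₁ < j₂ ∧ j₂ < 3 / 4 ∧
      ∀ s : ℝ, j₁ < 1 - s → 1 - s < j₂ → deriv (fun s : ℝ => Real.smoothTransition ((1 - s) / 1)) s < 0 := by
  set σ := Real.smoothTransition with hσ
  have hσd : Differentiable ℝ σ := Real.smoothTransition.contDiff.differentiable (by simp : ((1 : ℕ∞) : WithTop ℕ∞) ≠ 0)
  have hσ'c : Continuous (deriv σ) :=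
    (Real.smoothTransition.contDiff (n := 1)).continuous_deriv le_rfl
  -- mean value theorem on `[0, 3/4]`
  obtain ⟨ξ, hξ, hξd⟩ := exists_deriv_eq_slope σ (by norm_num : (0:ℝ) < 3 / 4) hσd.continuous.continuousOn
    (hσd.differentiableOn)
  have hpos : 0 < deriv σ ξ := by
    rw [hξd, hσ, Real.smoothTransition.zero, sub_zero]
    exact div_pos (Real.smoothTransition.pos_of_pos (by norm_num)) (by norm_num)
  -- continuity of `σ′` at `ξ`
  obtain ⟨δ, hδ, hδpos⟩ : ∃ δ > 0, ∀ z : ℝ, dist z ξ < δ → 0 < deriv σ z := by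
    have h := (hσ'c.continuousAt (x := ξ)).eventually (lt_mem_nhds hpos)
    obtain ⟨δ, hδ, hball⟩ := Metric.eventually_nhds_iff.1 h
    exact ⟨δ, hδ, fun z hz => hball hz⟩
  set δ' : ℝ := min δ (min ξ (3 / 4 - ξ)) / 2 with hδ'
  have hξ1 : 0 < ξ := hξ.1
  have hξ2 : ξ < 3 / 4 := hξ.2
  have hδ'pos : 0 < δ' := by
    have : 0 < min δ (min ξ (3 / 4 - ξ)) := lt_min hδ (lt_min hξ1 (by linarith)); rw [hδ']; linarith
  have hδ'le : δ' < δ := by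
    have : min δ (min ξ (3 / 4 - ξ)) ≤ δ := min_le_left _ _; rw [hδ']; linarith
  have hδ'ξ : δ' < ξ := by
    have : min δ (min ξ (3 / 4 - ξ)) ≤ ξ := (min_le_right _ _).trans (min_le_left _ _); rw [hδ']; linarith
  have hδ'ξ' : δ' < 3 / 4 - ξ := by
    have : min δ (min ξ (3 / 4 - ξ)) ≤ 3 / 4 - ξ := (min_le_right _ _).trans (min_le_right _ _); rw [hδ']; linarith
  refine ⟨ξ - δ', ξ + δ', by linarith, by linarith, by linarith, fun s hs1 hs2 => ?_⟩
  -- chain rule: `deriv g₁ s = -σ′(1 - s)`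
  have hchain : deriv (fun s : ℝ => σ ((1 - s) / 1)) s = -deriv σ (1 - s) := by
    have h1 : HasDerivAt (fun s : ℝ => (1 - s) / 1) (-1) s := by
      simpa using ((hasDerivAt_const s (1:ℝ)).sub (hasDerivAt_id s)).div_const (1:ℝ)
    have h2 := ((hσd ((1 - s) / 1)).hasDerivAt).comp s h1
    have h3 : deriv (fun s : ℝ => σ ((1 - s) / 1)) s = deriv σ ((1 - s) / 1) * -1 := h2.deriv
    rw [h3, div_one, mul_neg_one]
  rw [hchain, neg_lt_zero]
  exact hδpos (1 - s) (by rw [Real.dist_eq, abs_lt]; constructor <;> linarith)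

/-- The cutoff's derivative is bounded and non-positive everywhere (re-export of (δ2)'s letters at `κ = 1`). [folklore] -/
theorem exists_bound_cutoff_one_deriv :
    ∃ M : ℝ, 0 ≤ M ∧ ∀ s : ℝ, |deriv (fun s : ℝ => Real.smoothTransition ((1 - s) / 1)) s| ≤ M := by
  obtain ⟨M, hM0, hM⟩ := exists_bound_cutoff_deriv 1 1
  refine ⟨M, hM0, fun s => ?_⟩
  by_cases hs0 : s < 0
  · -- left of `0` the cutoff is constant `1`
    have h : deriv (fun s : ℝ => Real.smoothTransition ((1 - s) / 1)) s = 0 := by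
      have hev : ∀ᶠ z in 𝓝 s, Real.smoothTransition ((1 - z) / 1) = (1 : ℝ) := by
        filter_upwards [Iio_mem_nhds hs0] with z hz
        exact Real.smoothTransition.one_of_one_le (by rw [div_one]; linarith [mem_Iio.1 hz])
      rw [Filter.EventuallyEq.deriv_eq hev, deriv_const]
    rw [h, abs_zero]; exact hM0
  · by_cases hs1 : 1 < s
    · rw [Summit.QuantumFields.YangMills.Theorems.PoincareLipschitzRadialCutoffLetters.cutoff_deriv_eq_zero one_pos hs1, abs_zero]
      exact hM0
    · exact hM s ⟨not_lt.1 hs0, not_lt.1 hs1⟩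

end Summit.QuantumFields.YangMills.Theorems.PoincareLipschitzMonotonicityEqualityLetters

end
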